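import Mathlib

/-!
# Crux `RigidityForcesSymmetry.RigidMinimalRepr` (stmt-ValiantsHypothesis-4163), line `registered` —
# stub `stub_rankJump` (adding `a • E_rc` to a matrix with zero row `r` and zero column `c` changes the rank)

Route `ValiantsHypothesis/RigidityForcesSymmetry`, crux `RigidMinimalRepr`, skeleton
`Cruxes/RigidMinimalRepr/Lines/registered.lean` (run by the lead as a refutation of the crux), stub `stub_rankJump`.

**Statement.** Let `M ∈ M_n(ℂ)` have vanishing row `r` and vanishing column `c`, and let `a ≠ 0`.  Then
`rank (M + a·E_rc) ≠ rank M`, where `E_rc = Matrix.single r c 1`.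

**Proof.** We show the strict inclusion of column spaces
`range M < range (M + a·E_rc)` (as ranges of `mulVecLin`) and conclude with
`Submodule.finrank_lt_finrank_of_lt`.  Since `(M + a·E_rc) w = M w + (a w_c) e_r` and column `c` of `M`
vanishes, `M v = (M + a·E_rc)(v - v_c e_c)`, giving `≤`.  The vector `e_r = (M + a·E_rc)(a⁻¹ e_c)` lies in the
larger range, but not in `range M`: every `M w` has `r`-th coordinate `∑ j, M r j w_j = 0` because row `r` of `M`
vanishes.  In the lead's refutation this shows that the deformed coefficient matrix `A_u + t a E_rc` has left
the `GL × GL`-orbit of `A_u` (rank is an orbit invariant).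
-/

set_option autoImplicit false

-- the mandated summit-side namespace repeats a component by design (single-problem summit)
set_option linter.dupNamespace false

open scoped Matrix

namespace Summit.ValiantsHypothesis.ValiantsHypothesis.Theorems.RigidityForcesSymmetryRigidMinimalRepr

/-- Action of the perturbed matrix: `(M + a·E_rc) w = M w + (a * w c) • e_r`. -/
theorem rankJump_add_single_mulVec {n : ℕ} (M : Matrix (Fin n) (Fin n) ℂ) (r c : Fin n) (a : ℂ)
    (w : Fin n → ℂ) :
    (M + Matrix.single r c a) *ᵥ w = M *ᵥ w + (a * w c) • Pi.single r (1 : ℂ) := by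
  rw [Matrix.add_mulVec, Matrix.single_mulVec_eq]

/-- If column `c` of `M` vanishes, then `M` kills every multiple of `e_c`. -/
theorem rankJump_mulVec_single_of_col_zero {n : ℕ} (M : Matrix (Fin n) (Fin n) ℂ) (c : Fin n)
    (hc : ∀ i, M i c = 0) (x : ℂ) : M *ᵥ Pi.single c x = 0 := by
  ext i
  simp [hc]

/-- If row `r` of `M` vanishes, then the `r`-th coordinate of every `M w` vanishes. -/
theorem rankJump_mulVec_apply_of_row_zero {n : ℕ} (M : Matrix (Fin n) (Fin n) ℂ) (r : Fin n)
    (hr : ∀ j, M r j = 0) (w : Fin n → ℂ) : (M *ᵥ w) r = 0 := by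
  simp [Matrix.mulVec, dotProduct, hr]

/-- Column-space inclusion `range M ≤ range (M + a·E_rc)` when column `c` of `M` vanishes:
`M v = (M + a·E_rc) (v - v_c • e_c)`. -/
theorem rankJump_range_le {n : ℕ} (M : Matrix (Fin n) (Fin n) ℂ) (r c : Fin n) (a : ℂ)
    (hc : ∀ i, M i c = 0) :
    LinearMap.range M.mulVecLin ≤ LinearMap.range (M + Matrix.single r c a).mulVecLin := by
  rintro _ ⟨v, rfl⟩
  refine ⟨v - v c • Pi.single c 1, ?_⟩
  simp only [Matrix.mulVecLin_apply]
  have h1 : (v - v c • Pi.single c 1 : Fin n → ℂ) c = 0 := by simp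
  rw [rankJump_add_single_mulVec, h1, mul_zero, zero_smul, add_zero, Matrix.mulVec_sub,
    Matrix.mulVec_smul, rankJump_mulVec_single_of_col_zero M c hc, smul_zero, sub_zero]

/-- `e_r = (M + a·E_rc) (a⁻¹ • e_c)` lies in the column space of the perturbed matrix (`a ≠ 0`, column `c`
of `M` zero). -/
theorem rankJump_single_mem_range {n : ℕ} (M : Matrix (Fin n) (Fin n) ℂ) (r c : Fin n) {a : ℂ}
    (ha : a ≠ 0) (hc : ∀ i, M i c = 0) :
    Pi.single r (1 : ℂ) ∈ LinearMap.range (M + Matrix.single r c a).mulVecLin := by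
  refine ⟨Pi.single c a⁻¹, ?_⟩
  rw [Matrix.mulVecLin_apply, rankJump_add_single_mulVec, rankJump_mulVec_single_of_col_zero M c hc,
    zero_add, Pi.single_eq_same, mul_inv_cancel₀ ha, one_smul]

/-- `e_r` is not in the column space of a matrix whose row `r` vanishes. -/
theorem rankJump_single_not_mem_range {n : ℕ} (M : Matrix (Fin n) (Fin n) ℂ) (r : Fin n)
    (hr : ∀ j, M r j = 0) :
    Pi.single r (1 : ℂ) ∉ LinearMap.range M.mulVecLin := by
  rintro ⟨w, hw⟩
  have h := congrFun hw r
  rw [Matrix.mulVecLin_apply, rankJump_mulVec_apply_of_row_zero M r hr w, Pi.single_eq_same] at h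
  exact zero_ne_one h

/-- **Stub `stub_rankJump`.** If row `r` and column `c` of `M ∈ M_n(ℂ)` vanish and `a ≠ 0`, then
`rank (M + a·E_rc) ≠ rank M` (in fact the rank goes up by one; we only record `≠`). -/
theorem stub_rankJump :
    ∀ {n : ℕ} (M : Matrix (Fin n) (Fin n) ℂ) (r c : Fin n) {a : ℂ}, a ≠ 0 → (∀ j, M r j = 0) →
      (∀ i, M i c = 0) → (M + Matrix.single r c a).rank ≠ M.rank := by
  intro n M r c a ha hr hc
  have hlt : LinearMap.range M.mulVecLin < LinearMap.range (M + Matrix.single r c a).mulVecLin :=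
    lt_of_le_of_ne (rankJump_range_le M r c a hc) fun h =>
      rankJump_single_not_mem_range M r hr (h ▸ rankJump_single_mem_range M r c ha hc)
  exact (Submodule.finrank_lt_finrank_of_lt hlt).ne'

end Summit.ValiantsHypothesis.ValiantsHypothesis.Theorems.RigidityForcesSymmetryRigidMinimalRepr
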